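import Summits.BirchSwinnertonDyer.BirchSwinnertonDyer.Theorems.SignedLowerHalvesKobayashiLowerHalfSemistablePW21FourthRoots
import Summits.BirchSwinnertonDyer.BirchSwinnertonDyer.Theorems.SignedLowerHalvesKobayashiLowerHalfSemistablePW21NonEisensteinOdd
import Literature.NumberTheory.Automorphic.BrandtIndexReducedNorm
import Literature.NumberTheory.Automorphic.BrandtDataTransport
import Literature.NumberTheory.Automorphic.EichlerOrdersGenusLeftOrders
import Literature.NumberTheory.Automorphic.BrandtMatrixUnitCount
import Literature.NumberTheory.Automorphic.BrandtMatrixClassFunction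
import Literature.NumberTheory.Automorphic.BrandtEichlerLevelUOperators
import Literature.NumberTheory.Automorphic.DefiniteOrderUnitsFinite
import Mathlib.GroupTheory.Sylow
import HarnessLib

/-!
# The mod-`2` Eisenstein criterion in the Brandt module, part 2/2: a unit of order `4` in a class of even weight,
# `2 ∣ T(ℓ)_ij` off the diagonal for such a class, congruent weighted coordinates force Eisenstein eigenvalues mod `2`

Route-independent `Theorems` file (cell `b2b-bsdres`, seat `b2b-bsdres-x10b` = class owner X6/X7, gen 42); part 6 of the
series `…PW21CubeRoots` / `…PW21FixedIdeals` / `…DefmuPollackWestonLemma21` (gen 41) / `…PW21NonEisensteinOdd` /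
`…PW21FourthRoots` (gen 42).
HONEST FRAMING: prove what is provable now; shrink each hard class to its core with data; no claim beyond stated
classes. Nothing about any curve is asserted beyond the displayed hypotheses and NO summit statement is proved here;
BSD is not proved by any of this.

* `exists_orderOf_eq_four_of_dvd_weight` — a class `j` with EVEN weight `w_j = |O_L(I_j)ˣ| / 2` carries a unit of order
  `4` in `Stab(I_j) = O_L(I_j)ˣ` (a subgroup of order `4` exists by Sylow; its elements are not all of order `≤ 2`, since
  `x² = 1` forces `x = ±1` in the division algebra `D`); `fourthRoot_of_orderOf_eq_four` — such a unit has `u² = -1`.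
* `exists_eq_units_smul_rep_of_fourthRoot_fixed` — a `u`-fixed invertible sub-ideal `J ⊆ I_j` of index `ℓ²` (`ℓ` odd,
  `ℓ ∤ N⁺N⁻`) is `β I_j` (transport to the Eichler order `O_L(I_j)` and part 5's `exists_eq_units_smul_of_fourthRoot_fixed`).
* `two_dvd_matrix_of_dvd_weight` — **`2 ∣ T(ℓ)_ij` for `i ≠ j`, `2 ∣ w_j`, `ℓ ∤ 2N⁺N⁻` prime**: `⟨u⟩` (order `4`) acts on
  the Brandt set `{J ⊆ I_j : [I_j : J] = ℓ², [J] = i}` without fixed points.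
* `dvd_sub_prime_add_one_of_forall_dvd_weight_mul_two`, `dvd_sub_prime_add_one_of_forall_dvd_two` — the Eisenstein
  criterion at `p = 2`: a primitive eigenvector `v ∈ L(λ)` with `w_c v_c ≡ w_{c'} v_{c'} (mod 2)` for all `c, c'` has
  `λ(ℓ) ≡ ℓ + 1 (mod 2)` at every ODD prime `ℓ ∤ N⁺N⁻`.
* The assembly at EVERY prime and the elliptic-curve readings (`ρ̄_{E,p}` irreducible, any `p`; `p ∤ i_r`) are part 7,
  `…PW21NonEisensteinAnyPrime.lean`.

## References

* [PollackWeston2011] R. Pollack, T. Weston, Compos. Math. 147 (2011), §2.1 Lemma 2.1, §6.2 Prop. 6.3–6.4, §6.3.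
* [Takahashi2001] S. Takahashi, J. Number Theory 90 (2001), Lemma 2.2, Thm. 2.3, Thm. 2.7.
* [Ribet1990] K. Ribet, Invent. Math. 100 (1990), §3, Thm. 3.12.
* [Gross1987] B. H. Gross, *Heights and the special values of L-series* (1987), §§1–3.
* [Voight2021] J. Voight, *Quaternion Algebras*, GTM 288 (2021), (41.1.1), 41.1.3; §11.5 (unit groups of definite orders).
-/

noncomputable section

open scoped Pointwise Matrix TensorProduct BigOperators

open Literature.NumberTheory.Automorphic

universe u

-- D-0017: single-problem summit, the namespace repeats the problem name by design.
set_option linter.dupNamespace false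

namespace Summit.BirchSwinnertonDyer.BirchSwinnertonDyer.Theorems.PollackWestonLemma21

section Setups

open Literature.NumberTheory.Automorphic.Brandt

variable {Nplus Nminus : ℕ}

/-! ### Units of order `4` in a class of even weight -/

/-- In the definite quaternion algebra `D` of a Brandt setup, a unit with `x² = 1` is `±1`
(`(x - 1)(x + 1) = 0` in a division algebra). [folklore] -/
theorem units_eq_one_or_eq_neg_one_of_sq (S : XiSetup Nplus Nminus) {x : S.Dˣ} (hx : x ^ 2 = 1) :
    x = 1 ∨ x = -1 := by
  by_cases h1 : x = 1
  · exact Or.inl h1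
  · right
    have hne : (x : S.D) - 1 ≠ 0 := fun h => h1 (Units.ext (sub_eq_zero.mp h))
    have hfac : ((x : S.D) - 1) * ((x : S.D) + 1) = 0 := by
      have : ((x : S.D) - 1) * ((x : S.D) + 1) = (x : S.D) ^ 2 - 1 := by noncomm_ring
      rw [this, ← Units.val_pow_eq_pow_val, hx, Units.val_one, sub_self]
    obtain ⟨w, hw⟩ := isUnit_of_isTotallyDefinite S.D S.isTotallyDefinite hne
    have h := congrArg (fun y => ((w⁻¹ : S.Dˣ) : S.D) * y) hfac
    simp only [← mul_assoc, ← hw, Units.inv_mul, one_mul, mul_zero] at h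
    exact Units.ext (by rw [Units.val_neg, Units.val_one]; exact eq_neg_of_add_eq_zero_left h)

/-- **A class with even weight carries a unit of order `4`**: if `2 ∣ w_j = |O_L(I_j)ˣ| / 2`, then `4` divides the
order of the stabiliser `Stab_{Dˣ}(I_j) = O_L(I_j)ˣ`, which therefore has a subgroup `K` of order `4` (Sylow); not every
element of `K` satisfies `x² = 1` (only `±1` do, `units_eq_one_or_eq_neg_one_of_sq`), so some element of `K` has order
exactly `4`. (Equivalently: the unit group of a definite order has the single involution `-1`, so its `2`-Sylow
subgroups are cyclic or generalised quaternion.) [folklore] -/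
theorem exists_orderOf_eq_four_of_dvd_weight (S : XiSetup Nplus Nminus) (j : ClassSet S.O)
    (h2 : 2 ∣ weight S.O j) :
    ∃ u : S.Dˣ, u ∈ MulAction.stabilizer S.Dˣ j.rep ∧ orderOf u = 4 := by
  set G := MulAction.stabilizer S.Dˣ j.rep with hGdef
  have hcard : Nat.card G = 2 * weight S.O j := card_stabilizer_eq_two_mul_unitIndex S.one_ne_neg_one j.rep
  have hpos : 0 < weight S.O j := S.one_le_weight j
  haveI : Finite G := Nat.finite_of_card_ne_zero (by rw [hcard]; omega)
  haveI : Fact (Nat.Prime 2) := ⟨Nat.prime_two⟩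
  have h4 : 2 ^ 2 ∣ Nat.card G := by
    rw [hcard]; obtain ⟨k, hk⟩ := h2; exact ⟨k, by rw [hk]; ring⟩
  obtain ⟨K, hK⟩ := Sylow.exists_subgroup_card_pow_prime 2 h4
  by_contra hno
  push Not at hno
  -- every element of `K` is `±1`
  have hK1 : ∀ g : K, ((g : G) : S.Dˣ) = 1 ∨ ((g : G) : S.Dˣ) = -1 := by
    intro g
    set x : S.Dˣ := ((g : G) : S.Dˣ) with hxdef
    have hox : orderOf x = orderOf g := by
      rw [hxdef, Subgroup.orderOf_coe, Subgroup.orderOf_coe]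
    have hx4 : orderOf x ∣ 2 ^ 2 := by
      rw [hox, ← hK]; exact orderOf_dvd_natCard g
    obtain ⟨i, hi, hix⟩ := (Nat.dvd_prime_pow Nat.prime_two).mp hx4
    have hne4 : orderOf x ≠ 4 := hno x (g : G).2
    have hx2 : x ^ 2 = 1 := by
      interval_cases i
      · rw [pow_zero] at hix
        rw [orderOf_eq_one_iff.mp hix, one_pow]
      · rw [pow_one] at hix
        rw [← hix]; exact pow_orderOf_eq_one x
      · exact absurd hix (by simpa using hne4)
    exact units_eq_one_or_eq_neg_one_of_sq S hx2
  -- so `K` injects into `{1, -1}`, contradicting `|K| = 4`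
  have hne1 : (1 : S.Dˣ) ≠ -1 := fun h => S.one_ne_neg_one (by
    have := congrArg (fun y : S.Dˣ => (y : S.D)) h
    simpa using this)
  have hsub : ∀ g : K, ((g : G) : S.Dˣ) ∈ ({1, -1} : Set S.Dˣ) := fun g => by
    rcases hK1 g with h | h
    · rw [h]; exact Set.mem_insert _ _
    · rw [h]; exact Set.mem_insert_of_mem _ (Set.mem_singleton _)
  let f : K → ({1, -1} : Set S.Dˣ) := fun g => ⟨((g : G) : S.Dˣ), hsub g⟩
  have hinj : Function.Injective f := by
    intro g g' hgg'
    have heq : ((g : G) : S.Dˣ) = ((g' : G) : S.Dˣ) := by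
      have := congrArg Subtype.val hgg'
      simpa [f] using this
    exact Subtype.ext (Subtype.ext heq)
  have hle := Nat.card_le_card_of_injective f hinj
  rw [hK, Nat.card_coe_set_eq, Set.ncard_pair hne1] at hle
  norm_num at hle

/-- A unit of order `4` in `Dˣ` is a fourth root of unity with `u² = -1`: `(u² - 1)(u² + 1) = u⁴ - 1 = 0` and
`u² ≠ 1`. [folklore] -/
theorem fourthRoot_of_orderOf_eq_four (S : XiSetup Nplus Nminus) {u : S.Dˣ} (hu : orderOf u = 4) :
    (u : S.D) * u + 1 = 0 := by
  have h4 : u ^ 4 = 1 := by rw [← hu]; exact pow_orderOf_eq_one u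
  have hsq : (u ^ 2) ^ 2 = 1 := by rw [← pow_mul]; exact h4
  have hne : u ^ 2 ≠ 1 := pow_ne_one_of_lt_orderOf (by norm_num) (by rw [hu]; norm_num)
  rcases units_eq_one_or_eq_neg_one_of_sq S hsq with h | h
  · exact absurd h hne
  · have := congrArg (fun y : S.Dˣ => (y : S.D)) h
    simp only [Units.val_pow_eq_pow_val, Units.val_neg, Units.val_one] at this
    rw [← sq, this, neg_add_cancel]

/-! ### Transport: `u`-fixed sub-ideals of a class representative are principal -/

/-- **Transport to the left order.** Let `I_j` be a representative of the class `j`, `u` a unit with `u I_j = I_j` and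
`u² + 1 = 0`, `ℓ ∤ N⁺N⁻` an ODD prime, and `J ⊆ I_j` an invertible right `O`-ideal of index `ℓ²` with `u J = J`. Then
`J = β I_j` for some `β ∈ Dˣ`: the transporter `(J : I_j)` is a `u`-stable right sub-module of index `ℓ²` of the
Eichler order `O_L(I_j)`, hence principal by `exists_eq_units_smul_of_fourthRoot_fixed`, and
`J = (J : I_j) I_j = β O_L(I_j) I_j = β I_j`. (Twin of gen 41's `exists_eq_units_smul_rep_of_cubeRoot_fixed`.) [folklore] -/
theorem exists_eq_units_smul_rep_of_fourthRoot_fixed (S : XiSetup Nplus Nminus)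
    (j : ClassSet S.O) {u : S.Dˣ} (hu : u ∈ MulAction.stabilizer S.Dˣ j.rep)
    (hfour : (u : S.D) * u + 1 = 0) {ℓ : ℕ} (hℓ : ℓ.Prime) (hℓ2 : ℓ ≠ 2) (hℓN : ¬ ℓ ∣ Nplus * Nminus)
    {J : Submodule ℤ S.D} (hJinv : IsInvertibleRightIdeal S.O J) (hJle : J ≤ j.rep)
    (hidx : J.toAddSubgroup.relIndex j.rep.toAddSubgroup = ℓ ^ 2) (hfix : u • J = J) :
    ∃ β : S.Dˣ, J = β • j.rep := by
  haveI : Fact ℓ.Prime := ⟨hℓ⟩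
  have hdef := S.isTotallyDefinite
  have hdiv : ∀ x : S.D, x ≠ 0 → IsUnit x := fun x hx => isUnit_of_isTotallyDefinite S.D hdef hx
  have hZ : IsZOrder S.O := isZOrder_iff_isOrder.mpr S.isEichlerOrder.isOrder
  have hri : rightIdeals S.O = invertibleRightIdeals S.O :=
    rightIdeals_eq_invertibleRightIdeals_of_isTotallyDefinite hdef hZ
  have hI : IsInvertibleRightIdeal S.O j.rep := by
    have hj := j.rep_mem; rw [hri] at hj; exact hj
  set R := leftOrderOf j.rep with hRdef
  have hR : IsZOrder R := hI.isZOrder_leftOrderOf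
  have hRE : _root_.Literature.NumberTheory.Automorphic.IsEichlerOrder R Nplus :=
    isEichlerOrder_iff_brandt.mpr (S.isEichlerOrder_leftOrder_rep j)
  obtain ⟨ψ, hψ⟩ := exists_isMatrixResidueMap_of_isEichlerOrder hRE (p := ℓ)
    (fun h => hℓN (dvd_mul_of_dvd_left h Nminus))
    (S.nonempty_algEquiv_padic fun h => hℓN (dvd_mul_of_dvd_right h Nplus))
  have hustab : u • j.rep = j.rep := MulAction.mem_stabilizer_iff.mp hu
  have huR : (u : S.D) ∈ R := (units_smul_le_iff_mem_leftOrder j.rep u).mp hustab.le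
  -- the transporter `M = (J : I_j) ⊆ R`
  set M := transporterLeft j.rep J with hMdef
  have hMR : M ≤ R := fun x hx m hm => hJle (hx m hm)
  have hmul : ∀ m ∈ M, ∀ a ∈ R, m * a ∈ M := fun m hm a ha y hy => by
    rw [mul_assoc]; exact hm _ (ha y hy)
  have hidxM : M.toAddSubgroup.relIndex R.toAddSubgroup = ℓ ^ 2 := by
    rw [hRdef, ← transporterLeft_self, hMdef, relIndex_transporterLeft hdiv hZ hI hI hJinv hJle, hidx]
  have hfixM : ∀ m ∈ M, (u : S.D) * m ∈ M := fun m hm y hy => by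
    rw [mul_assoc]
    have hmy : m * y ∈ J := hm y hy
    have : u • (m * y) ∈ u • J := Submodule.smul_mem_pointwise_smul _ u J hmy
    rwa [hfix, Units.smul_def, smul_eq_mul] at this
  obtain ⟨β, -, hMβ⟩ := exists_eq_units_smul_of_fourthRoot_fixed hdef hR hℓ2 hψ huR hfour hMR hmul hidxM hfixM
  refine ⟨β, ?_⟩
  have hJM : J = M * j.rep := (transporterLeft_mul_eq hdiv hZ hI hJinv).symm
  have hRI : R * j.rep = j.rep := by
    rw [hRdef, ← transporterLeft_self]; exact transporterLeft_mul_eq hdiv hZ hI hI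
  rw [hJM, hMβ, ← units_smul_mul, hRI]

/-! ### `2 ∣ T(ℓ)_ij` off the diagonal for a class of even weight -/

/-- **The Brandt-matrix columns of a class with even weight are EVEN off the diagonal, at every odd prime `ℓ ∤ N⁺N⁻`.**
For a Brandt setup of type `(N⁺, N⁻)`, an odd prime `ℓ ∤ N⁺N⁻` and classes `i ≠ j` with `2 ∣ w_j`:
`2 ∣ T(ℓ)_ij = #{J ⊆ I_j : [I_j : J] = ℓ², [J] = i}`. The cyclic group of order `4` generated by a unit `u` of order `4`
of `O_L(I_j)` acts on this Brandt set by `J ↦ u J` without fixed points (a fixed `J` would be `β I_j`, of class `j`),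
so the set has even cardinality. Twin of gen 41's `three_dvd_matrix_of_dvd_weight`. [folklore] -/
theorem two_dvd_matrix_of_dvd_weight (S : XiSetup Nplus Nminus) {ℓ : ℕ} (hℓ : ℓ.Prime) (hℓ2 : ℓ ≠ 2)
    (hℓN : ¬ ℓ ∣ Nplus * Nminus) {i j : ClassSet S.O} (hij : i ≠ j) (h2 : 2 ∣ weight S.O j) :
    (2 : ℤ) ∣ matrix S.O ℓ i j := by
  classical
  haveI : IsAddTorsionFree S.D := S.isAddTorsionFree
  obtain ⟨u, hustab, hu4⟩ := exists_orderOf_eq_four_of_dvd_weight S j h2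
  have hfour := fourthRoot_of_orderOf_eq_four S hu4
  have hdef := S.isTotallyDefinite
  have hZ : IsZOrder S.O := isZOrder_iff_isOrder.mpr S.isEichlerOrder.isOrder
  have hIi : IsInvertibleRightIdeal S.O i.rep := by
    have hi := i.rep_mem
    rw [rightIdeals_eq_invertibleRightIdeals_of_isTotallyDefinite hdef hZ] at hi
    exact hi
  -- the Brandt set and the action of `⟨u⟩` on it
  set X : Set (Submodule ℤ S.D) := {J | J ≤ j.rep ∧
    J.toAddSubgroup.relIndex j.rep.toAddSubgroup = ℓ ^ 2 ∧ ∃ α : S.Dˣ, J = α • i.rep} with hX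
  have hTX : matrix S.O ℓ i j = (X.ncard : ℤ) := by rw [matrix, Matrix.of_apply]
  have hXfin : X.Finite := finite_brandtSet i j hℓ.ne_zero
  haveI : Finite X := hXfin.to_subtype
  set G := Subgroup.zpowers u with hG
  have hGle : G ≤ MulAction.stabilizer S.Dˣ j.rep := (Subgroup.zpowers_le).mpr hustab
  have hmemX : ∀ (g : G) (J : X), ((g : S.Dˣ) • (J : Submodule ℤ S.D)) ∈ X := fun g J => by
    have hg : (g : S.Dˣ) • j.rep = j.rep := MulAction.mem_stabilizer_iff.mp (hGle g.2)
    obtain ⟨hJle, hJidx, α, hJα⟩ := J.2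
    refine ⟨?_, ?_, ⟨(g : S.Dˣ) * α, by rw [hJα, mul_smul]⟩⟩
    · calc (g : S.Dˣ) • (J : Submodule ℤ S.D) ≤ (g : S.Dˣ) • j.rep :=
            (units_smul_le_units_smul_iff _).mpr hJle
        _ = j.rep := hg
    · rw [← hJidx, ← Brandt.relIndex_units_smul (g : S.Dˣ) (J : Submodule ℤ S.D) j.rep, hg]
  letI : MulAction G X :=
    { smul := fun g J => ⟨(g : S.Dˣ) • (J : Submodule ℤ S.D), hmemX g J⟩
      one_smul := fun J => Subtype.ext (one_smul S.Dˣ (J : Submodule ℤ S.D))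
      mul_smul := fun g g' J => Subtype.ext (mul_smul (g : S.Dˣ) (g' : S.Dˣ) (J : Submodule ℤ S.D)) }
  haveI : Fact (Nat.Prime 2) := ⟨Nat.prime_two⟩
  have hGp : IsPGroup 2 G := IsPGroup.of_card (n := 2) (by rw [hG, Nat.card_zpowers, hu4]; norm_num)
  have hmod := hGp.card_modEq_card_fixedPoints X
  -- no fixed points
  have hempty : MulAction.fixedPoints G X = ∅ := by
    refine Set.eq_empty_iff_forall_notMem.mpr fun J hJ => hij ?_
    have hfix : u • (J : Submodule ℤ S.D) = J :=
      congrArg Subtype.val (hJ ⟨u, Subgroup.mem_zpowers u⟩)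
    obtain ⟨hJle, hJidx, α, hJα⟩ := J.2
    have hJinv : IsInvertibleRightIdeal S.O (J : Submodule ℤ S.D) := by
      rw [hJα]; exact IsInvertibleRightIdeal.units_smul α hIi
    obtain ⟨β, hβ⟩ :=
      exists_eq_units_smul_rep_of_fourthRoot_fixed S j hustab hfour hℓ hℓ2 hℓN hJinv hJle hJidx hfix
    -- `α I_i = β I_j`: the classes coincide
    have hrel : i.rep = (α⁻¹ * β) • j.rep := by rw [mul_smul, ← hβ, hJα, inv_smul_smul]
    have hji : (Quotient.mk (rightClassSetoid S.O) ⟨j.rep, j.rep_mem⟩ : ClassSet S.O) =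
        Quotient.mk (rightClassSetoid S.O) ⟨i.rep, i.rep_mem⟩ := Quotient.sound ⟨α⁻¹ * β, hrel⟩
    rw [ClassSet.mk_rep, ClassSet.mk_rep] at hji
    exact hji.symm
  have h0 : Nat.card (MulAction.fixedPoints G X) = 0 := by rw [hempty]; simp
  rw [h0, Nat.card_coe_set_eq] at hmod
  rw [hTX]
  exact Int.natCast_dvd_natCast.mpr (Nat.modEq_zero_iff_dvd.mp hmod)

/-! ### The criterion at `p = 2` -/

/-- **At `p = 2`: a primitive eigenvector all of whose weighted coordinates are even is Eisenstein at every odd good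
prime.** `v ∈ L(λ)`, `2 ∤ v_{c₀}`, `2 ∣ w_c v_c` for every `c` `⇒ λ(ℓ) ≡ ℓ + 1 (mod 2)` for every ODD prime `ℓ ∤ N⁺N⁻`:
`2 ∣ w_{c₀}`; in row `c₀` of `T(ℓ) v = λ(ℓ) v` the off-diagonal terms are even (`2 ∣ v_c`, or `2 ∣ w_c` and
`two_dvd_matrix_of_dvd_weight`), and `T_{c₀ c₀} ≡ ℓ + 1 (mod 2)` (column sum `ℓ + 1`, off-diagonal entries of column `c₀`
even). [folklore] -/
theorem dvd_sub_prime_add_one_of_forall_dvd_weight_mul_two (S : XiSetup Nplus Nminus) [Fintype (ClassSet S.O)]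
    {lam : ℕ → ℤ} {v : ClassSet S.O → ℤ} (hv : v ∈ eigenLattice (Nplus * Nminus) (matrix S.O) lam)
    {c₀ : ClassSet S.O} (hv0 : ¬ (2 : ℤ) ∣ v c₀) (hall : ∀ c, (2 : ℤ) ∣ (weight S.O c : ℤ) * v c)
    {ℓ : ℕ} (hℓ : ℓ.Prime) (hℓ2 : ℓ ≠ 2) (hℓN : ¬ ℓ ∣ Nplus * Nminus) :
    (2 : ℤ) ∣ lam ℓ - (ℓ + 1) := by
  classical
  have h2Z : Prime (2 : ℤ) := Int.prime_two
  have hpw : 2 ∣ weight S.O c₀ := by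
    have := (h2Z.dvd_or_dvd (hall c₀)).resolve_right hv0
    exact_mod_cast this
  have heig := (mem_eigenLattice_iff.mp hv) ℓ hℓ hℓN
  have hc : ∑ j, matrix S.O ℓ c₀ j * v j = lam ℓ * v c₀ := by
    have := congr_fun heig c₀
    simpa [Matrix.mulVec, dotProduct] using this
  have hterm : ∀ j ∈ Finset.univ.erase c₀, (2 : ℤ) ∣ matrix S.O ℓ c₀ j * v j := by
    intro j hj
    have hjc : j ≠ c₀ := Finset.ne_of_mem_erase hj
    by_cases hw : 2 ∣ weight S.O j
    · exact (two_dvd_matrix_of_dvd_weight S hℓ hℓ2 hℓN hjc.symm hw).mul_right _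
    · have hw' : ¬ (2 : ℤ) ∣ (weight S.O j : ℤ) := fun h => hw (by exact_mod_cast h)
      exact ((h2Z.dvd_or_dvd (hall j)).resolve_left hw').mul_left _
  have hdiag : (2 : ℤ) ∣ matrix S.O ℓ c₀ c₀ - (ℓ + 1) := by
    have hsum := S.sum_matrix_prime_eq hℓ hℓN c₀
    rw [← Finset.add_sum_erase _ _ (Finset.mem_univ c₀)] at hsum
    have : matrix S.O ℓ c₀ c₀ - (ℓ + 1) = -∑ i ∈ Finset.univ.erase c₀, matrix S.O ℓ i c₀ := by
      linarith
    rw [this]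
    exact (Finset.dvd_sum fun i hi =>
      two_dvd_matrix_of_dvd_weight S hℓ hℓ2 hℓN (Finset.ne_of_mem_erase hi) hpw).neg_right
  have hkey : (2 : ℤ) ∣ (lam ℓ - (ℓ + 1)) * v c₀ := by
    have : (lam ℓ - (ℓ + 1)) * v c₀ =
        (∑ j ∈ Finset.univ.erase c₀, matrix S.O ℓ c₀ j * v j) + (matrix S.O ℓ c₀ c₀ - (ℓ + 1)) * v c₀ := by
      rw [sub_mul, ← hc, ← Finset.add_sum_erase _ _ (Finset.mem_univ c₀)]
      ring
    rw [this]
    exact dvd_add (Finset.dvd_sum hterm) (hdiag.mul_right _)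
  exact (h2Z.dvd_or_dvd hkey).resolve_right hv0

/-- **Congruent weighted coordinates force Eisenstein eigenvalues, at `p = 2`** (odd good primes `ℓ`): if `v ∈ L(λ)`,
`2 ∤ v_{c₀}` and `w_c v_c ≡ w_{c'} v_{c'} (mod 2)` for all `c, c'`, then `λ(ℓ) ≡ ℓ + 1 (mod 2)` for every odd prime
`ℓ ∤ N⁺N⁻` (case `2 ∤ w_{c₀} v_{c₀}`: the abstract criterion; case `2 ∣ w_{c₀} v_{c₀}`: all `w_c v_c` even,
`dvd_sub_prime_add_one_of_forall_dvd_weight_mul_two`). [folklore] -/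
theorem dvd_sub_prime_add_one_of_forall_dvd_two (S : XiSetup Nplus Nminus) [Fintype (ClassSet S.O)]
    {lam : ℕ → ℤ} {v : ClassSet S.O → ℤ} (hv : v ∈ eigenLattice (Nplus * Nminus) (matrix S.O) lam)
    {c₀ : ClassSet S.O} (hv0 : ¬ (2 : ℤ) ∣ v c₀)
    (hcong : ∀ c c', (2 : ℤ) ∣ (weight S.O c : ℤ) * v c - (weight S.O c' : ℤ) * v c')
    {ℓ : ℕ} (hℓ : ℓ.Prime) (hℓ2 : ℓ ≠ 2) (hℓN : ¬ ℓ ∣ Nplus * Nminus) :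
    (2 : ℤ) ∣ lam ℓ - (ℓ + 1) := by
  by_cases hw0 : (2 : ℤ) ∣ (weight S.O c₀ : ℤ) * v c₀
  · refine dvd_sub_prime_add_one_of_forall_dvd_weight_mul_two S hv hv0 (fun c => ?_) hℓ hℓ2 hℓN
    have h := dvd_add (hcong c c₀) hw0
    simpa using h
  · exact dvd_sub_of_forall_dvd_weight_mul_sub (matrix S.O ℓ) (fun c => (weight S.O c : ℤ))
      (fun i j => S.weight_mul_matrix_symm ℓ i j) (fun j => S.sum_matrix_prime_eq hℓ hℓN j)
      ((mem_eigenLattice_iff.mp hv) ℓ hℓ hℓN) Int.prime_two hw0 hcong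

end Setups

end Summit.BirchSwinnertonDyer.BirchSwinnertonDyer.Theorems.PollackWestonLemma21

end
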